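import Summits.BirchSwinnertonDyer.BirchSwinnertonDyer.Theorems.SignedLowerHalvesSprungLowerDivisibilityAtThreeIotaRigidity
import HarnessLib

/-!
# Crux `SprungLowerDivisibilityAtThree` (K1, item stmt-BirchSwinnertonDyer-19875), line `chromatic-common-zeros`:
# ι-DESCENT — the ι-conjugate `f^ι` of a distinguished polynomial, self-dual primes, and the digit identities for
# «no ι-self-dual quadratic `T² − σT − σ` divides `F`» (pure `Λ = ℤ_p⟦T⟧` / `ℤ_p[T]` algebra, `p` any prime)

Cell `bsd-ssimc` (host), width seat `cruxlead-stmt-BirchSwinnertonDyer-19875-w2` (g5) under the 19875 lead; `--supports` 19875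
`--as helper`; THEOREMS ONLY; closes NO item (skeleton v8 unchanged). K1, BSD and leaf X8 are NOT proved by anything here. The X8
door built on this file (ι-descent at `λ_min = 4`) is in the sibling file `…IotaDescent.lean`.

## The mechanism

Let `ι : T ↦ (1+T)⁻¹ − 1` (`invOnePlusSubOne`). For a distinguished `f ∈ ℤ_p[T]` of degree `m` the power series `f ∘ ι` generates
the same ideal of `Λ` as the polynomial `g_f(T) := (1+T)^m·f(ι(T)) = Σ_j f_j (−T)^j (1+T)^{m−j}` (because `(1+T)·ι(T) = −T`), whose
leading coefficient `f(−1) ≡ (−1)^m` is a unit; `f^ι := f(−1)⁻¹·g_f` is again distinguished of degree `m`, and `(f ∘ ι)·Λ = (f^ι)·Λ`.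
Comparing constant coefficients, `f^ι(0) = f(0)/f(−1)`, so a SELF-DUAL `f` (`f^ι = f`, `f(0) ≠ 0`) has `f(−1) = 1`, forcing `m`
even when `p ≠ 2`; the self-dual distinguished quadratics with `f(0) ≠ 0` are exactly `T² + bT + b = T² − σT − σ` (`σ = −b`), the
`(T − a)(T − a′)` with `(1+a)(1+a′) = 1`. Finally, if `T² − σT − σ` divides `F = Σ F_i T^i` in `Λ`, then (coefficient identities
`F_i = H_{i−2} − σH_{i−1} − σH_i`) `σ³ ∣ F₀ + σF₂ + σ²(F₃ + F₄)` and `σ³ ∣ F₁ + σ(F₂ + F₃) + σ²(F₃ + 2F₄ + F₅)` — two congruences a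
census can refute from finitely many `p`-adic digits of `F₀,…,F₅`, uniformly in `σ ∈ pℤ_p`.

## Contents (namespace `…Theorems.ChromaticIotaDescent`)

* §1 `one_add_X_mul_iota` (`(1+T)·ι = −T`), `iota_iota`, `mem_span_iota_of_iota_mem_span` (`ιF ∈ (f) ⟹ F ∈ (ιf)`),
  `isUnit_one_add_X`, `isUnit_one_add_of_mem_maximalIdeal`.
* §2 degree 1/2/3: `mul_partner_eq_selfDualQuad` (`(T − a)(T − a′) = T² − σT − σ`, `σ = a + a′`), **`twist_two`**, **`twist_three`**
  (existence of `f^ι` with `(f ∘ ι) = (f^ι)`, its coefficients in `𝔪`, and the relations `f(−1)·f^ι_j = g_{f,j}`),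
  `isDistinguishedAt_quadratic`, `isDistinguishedAt_cubic`, `mul_dvd_of_isRoot_of_isRoot`.
* §3 **`pow_three_dvd_of_selfDualQuad_dvd`** (the two `σ³`-congruences).

References: [GreenbergLNM1716] §1 (the involution `T^ι`) and §5 (the root pairing `a ↦ (1+a)⁻¹ − 1`); [Washington1997] §7.1 (distinguished
polynomials, Weierstrass preparation), §13.2; [MazurTateTeitelbaum1986Invent] Ch. I §17 (the involution of `Λ`); tree: `…IotaRigidity`
(`partner_mem_ne`, `dvd_of_coe_dvd_coe`), `Literature/Barriers/…/PAdicFunctionalEquationParity` (`invOnePlusSubOne`).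
-/

set_option linter.dupNamespace false
set_option autoImplicit false

noncomputable section

open scoped Classical Polynomial

open Polynomial Literature.NumberTheory.EllipticCurves Literature.Barriers.BirchSwinnertonDyer
  Summit.BirchSwinnertonDyer.BirchSwinnertonDyer.Theorems.ChromaticIota

namespace Summit.BirchSwinnertonDyer.BirchSwinnertonDyer.Theorems.ChromaticIotaDescent

variable {p : ℕ} [hp : Fact p.Prime]

/-! ### §1 `ι`-plumbing in `Λ` -/

/-- `(1 + T)·ι(T) = −T` for `ι(T) = (1+T)⁻¹ − 1`. [cite: GreenbergLNM1716, §1] -/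
theorem one_add_X_mul_iota :
    (1 + PowerSeries.X : IwasawaAlgebra p) * invOnePlusSubOne = -PowerSeries.X := by
  linear_combination one_add_X_mul_invOnePlusSubOne_add_one (R := ℤ_[p])

/-- `ι ∘ ι = id` on `Λ`. [cite: MazurTateTeitelbaum1986Invent, Ch. I §17] -/
theorem iota_iota (g : IwasawaAlgebra p) :
    PowerSeries.subst (invOnePlusSubOne : IwasawaAlgebra p)
      (PowerSeries.subst (invOnePlusSubOne : IwasawaAlgebra p) g) = g := by
  have hι := hasSubst_invOnePlusSubOne (R := ℤ_[p])
  rw [PowerSeries.subst_comp_subst_apply hι hι, invOnePlusSubOne_subst_self, PowerSeries.X_subst]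

/-- `ι F ∈ (f) ⟹ F ∈ (ι f)` (apply the ring automorphism `ι = ι⁻¹`). [cite: MazurTateTeitelbaum1986Invent, Ch. I §17] -/
theorem mem_span_iota_of_iota_mem_span {F f : IwasawaAlgebra p}
    (h : PowerSeries.subst (invOnePlusSubOne : IwasawaAlgebra p) F ∈ Ideal.span {f}) :
    F ∈ Ideal.span {PowerSeries.subst (invOnePlusSubOne : IwasawaAlgebra p) f} := by
  have hι := hasSubst_invOnePlusSubOne (R := ℤ_[p])
  obtain ⟨h', hh⟩ := Ideal.mem_span_singleton'.mp h
  have hF : F = PowerSeries.subst (invOnePlusSubOne : IwasawaAlgebra p) h' *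
      PowerSeries.subst (invOnePlusSubOne : IwasawaAlgebra p) f := by
    rw [← PowerSeries.subst_mul hι, hh, iota_iota]
  rw [hF]
  exact Ideal.mul_mem_left _ _ (Ideal.subset_span rfl)

/-- `1 + T` is a unit of `Λ`. [folklore] -/
theorem isUnit_one_add_X : IsUnit (1 + PowerSeries.X : IwasawaAlgebra p) := by
  rw [PowerSeries.isUnit_iff_constantCoeff, map_add, map_one, PowerSeries.constantCoeff_X, add_zero]
  exact isUnit_one

/-- `1 + a` is a unit of `ℤ_p` for `a ∈ 𝔪`. [folklore] -/
theorem isUnit_one_add_of_mem_maximalIdeal {a : ℤ_[p]} (ha : a ∈ IsLocalRing.maximalIdeal ℤ_[p]) :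
    IsUnit (1 + a) := by
  by_contra hnu
  have hm : 1 + a ∈ IsLocalRing.maximalIdeal ℤ_[p] :=
    (IsLocalRing.mem_maximalIdeal _).mpr (mem_nonunits_iff.mpr hnu)
  have h1m : (1 : ℤ_[p]) ∈ IsLocalRing.maximalIdeal ℤ_[p] := by
    have := Ideal.sub_mem _ hm ha
    rwa [add_sub_cancel_right] at this
  exact (IsLocalRing.maximalIdeal.isMaximal ℤ_[p]).ne_top (Ideal.eq_top_of_isUnit_mem _ h1m isUnit_one)

/-- `a ∈ 𝔪_{ℤ_p} ↔ p ∣ a`. [folklore] -/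
theorem mem_maximalIdeal_iff_natCast_dvd (a : ℤ_[p]) :
    a ∈ IsLocalRing.maximalIdeal ℤ_[p] ↔ (p : ℤ_[p]) ∣ a := by
  rw [PadicInt.maximalIdeal_eq_span_p, Ideal.mem_span_singleton]

/-! ### §2 The `ι`-conjugate of a distinguished polynomial of degree `1`, `2`, `3` -/

/-- Degree `1`: `(T − a)(T − a′) = T² − σT − σ` with `σ = a + a′`, for partners `(1+a)(1+a′) = 1`
(so `aa′ = −(a + a′)`). [cite: GreenbergLNM1716, §5 (closing examples)] -/
theorem mul_partner_eq_selfDualQuad {R : Type*} [CommRing R] {a a' : R} (haa' : (1 + a) * (1 + a') = 1) :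
    (X - C a) * (X - C a') = X ^ 2 - C (a + a') * X - C (a + a') := by
  have hprod : a * a' = -(a + a') := by linear_combination haa'
  have hC : C a * C a' = -(C a + C a') := by rw [← map_mul, hprod, map_neg, map_add]
  rw [map_add]
  linear_combination hC

/-- `(T − a)(T − b) ∣ P` when `a ≠ b` are roots of `P` (over the domain `ℤ_p`). [folklore] -/
theorem mul_dvd_of_isRoot_of_isRoot {P : ℤ_[p][X]} {a b : ℤ_[p]} (ha : P.IsRoot a) (hb : P.IsRoot b) (hne : a ≠ b) :
    (X - C a) * (X - C b) ∣ P := by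
  obtain ⟨Q, hQ⟩ := dvd_iff_isRoot.mpr ha
  have hQb : Q.IsRoot b := by
    have h := hb
    rw [IsRoot.def, hQ, eval_mul, eval_sub, eval_X, eval_C] at h
    exact (mul_eq_zero.mp h).resolve_left (sub_ne_zero.mpr hne.symm)
  rw [hQ]
  exact mul_dvd_mul_left _ (dvd_iff_isRoot.mpr hQb)

/-- A quadratic `T² + βT + γ` with `β, γ ∈ 𝔪` is distinguished (of degree `2`). [cite: Washington1997, §7.1] -/
theorem isDistinguishedAt_quadratic {β γ : ℤ_[p]} (hβ : β ∈ IsLocalRing.maximalIdeal ℤ_[p])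
    (hγ : γ ∈ IsLocalRing.maximalIdeal ℤ_[p]) :
    (C 1 * X ^ 2 + C β * X + C γ : ℤ_[p][X]).IsDistinguishedAt (IsLocalRing.maximalIdeal ℤ_[p]) ∧
      (C 1 * X ^ 2 + C β * X + C γ : ℤ_[p][X]).natDegree = 2 := by
  have hdeg : (C 1 * X ^ 2 + C β * X + C γ : ℤ_[p][X]).natDegree = 2 := natDegree_quadratic one_ne_zero
  have hmon : (C 1 * X ^ 2 + C β * X + C γ : ℤ_[p][X]).Monic := by
    rw [Monic, leadingCoeff_quadratic one_ne_zero]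
  refine ⟨⟨⟨fun {n} hn => ?_⟩, hmon⟩, hdeg⟩
  rw [hdeg] at hn
  rcases (by omega : n = 0 ∨ n = 1) with rfl | rfl
  · simpa using hγ
  · simpa using hβ

/-- A cubic `T³ + αT² + βT + γ` with `α, β, γ ∈ 𝔪` is distinguished (of degree `3`). [cite: Washington1997, §7.1] -/
theorem isDistinguishedAt_cubic {α β γ : ℤ_[p]} (hα : α ∈ IsLocalRing.maximalIdeal ℤ_[p])
    (hβ : β ∈ IsLocalRing.maximalIdeal ℤ_[p]) (hγ : γ ∈ IsLocalRing.maximalIdeal ℤ_[p]) :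
    (C 1 * X ^ 3 + C α * X ^ 2 + C β * X + C γ : ℤ_[p][X]).IsDistinguishedAt (IsLocalRing.maximalIdeal ℤ_[p]) ∧
      (C 1 * X ^ 3 + C α * X ^ 2 + C β * X + C γ : ℤ_[p][X]).natDegree = 3 := by
  have hdeg : (C 1 * X ^ 3 + C α * X ^ 2 + C β * X + C γ : ℤ_[p][X]).natDegree = 3 := natDegree_cubic one_ne_zero
  have hmon : (C 1 * X ^ 3 + C α * X ^ 2 + C β * X + C γ : ℤ_[p][X]).Monic := by
    rw [Monic, leadingCoeff_cubic one_ne_zero]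
  refine ⟨⟨⟨fun {n} hn => ?_⟩, hmon⟩, hdeg⟩
  rw [hdeg] at hn
  rcases (by omega : n = 0 ∨ n = 1 ∨ n = 2) with rfl | rfl | rfl
  · simpa using hγ
  · simpa using hβ
  · simpa using hα

/-- `ι` of a polynomial, coerced into `Λ`, is `aeval ι` (Mathlib `PowerSeries.subst_coe`), here for the explicit quadratic. [folklore] -/
theorem iota_coe_quadratic (b c : ℤ_[p]) :
    PowerSeries.subst (invOnePlusSubOne : IwasawaAlgebra p) ((C 1 * X ^ 2 + C b * X + C c : ℤ_[p][X]) : IwasawaAlgebra p) =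
      invOnePlusSubOne ^ 2 + PowerSeries.C b * invOnePlusSubOne + PowerSeries.C c := by
  have hι := hasSubst_invOnePlusSubOne (R := ℤ_[p])
  rw [PowerSeries.subst_coe hι]
  simp only [map_add, map_mul, map_pow, map_one, Polynomial.aeval_X, Polynomial.aeval_C, one_mul,
    ← PowerSeries.C_eq_algebraMap]

/-- The same for the explicit cubic. [folklore] -/
theorem iota_coe_cubic (α β γ : ℤ_[p]) :
    PowerSeries.subst (invOnePlusSubOne : IwasawaAlgebra p)
        ((C 1 * X ^ 3 + C α * X ^ 2 + C β * X + C γ : ℤ_[p][X]) : IwasawaAlgebra p) =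
      invOnePlusSubOne ^ 3 + PowerSeries.C α * invOnePlusSubOne ^ 2 + PowerSeries.C β * invOnePlusSubOne +
        PowerSeries.C γ := by
  have hι := hasSubst_invOnePlusSubOne (R := ℤ_[p])
  rw [PowerSeries.subst_coe hι]
  simp only [map_add, map_mul, map_pow, map_one, Polynomial.aeval_X, Polynomial.aeval_C, one_mul,
    ← PowerSeries.C_eq_algebraMap]

/-- **`ι`-conjugate in degree 2.** For `f = T² + bT + c` with `b, c ∈ 𝔪` there is a distinguished quadratic
`f^ι = T² + βT + γ` (`β, γ ∈ 𝔪`) with `(f ∘ ι)·Λ = (f^ι)·Λ`, namely `f^ι = f(−1)⁻¹·(c(1+T)² − bT(1+T) + T²)`: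
`f(−1)·γ = c` and `f(−1)·β = 2c − b` where `f(−1) = 1 − b + c`. [cite: GreenbergLNM1716, §1] [cite: Washington1997, §7.1] -/
theorem twist_two {b c : ℤ_[p]} (hb : b ∈ IsLocalRing.maximalIdeal ℤ_[p]) (hc : c ∈ IsLocalRing.maximalIdeal ℤ_[p]) :
    ∃ β γ : ℤ_[p], β ∈ IsLocalRing.maximalIdeal ℤ_[p] ∧ γ ∈ IsLocalRing.maximalIdeal ℤ_[p] ∧
      (1 - b + c) * γ = c ∧ (1 - b + c) * β = 2 * c - b ∧
      Ideal.span {PowerSeries.subst (invOnePlusSubOne : IwasawaAlgebra p)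
          ((C 1 * X ^ 2 + C b * X + C c : ℤ_[p][X]) : IwasawaAlgebra p)} =
        Ideal.span {((C 1 * X ^ 2 + C β * X + C γ : ℤ_[p][X]) : IwasawaAlgebra p)} := by
  have he : IsUnit (1 - b + c) := by
    have h1 : 1 - b + c = 1 + (c - b) := by ring
    rw [h1]
    exact isUnit_one_add_of_mem_maximalIdeal (Ideal.sub_mem _ hc hb)
  obtain ⟨e, he'⟩ := he
  refine ⟨(↑e⁻¹ : ℤ_[p]) * (2 * c - b), (↑e⁻¹ : ℤ_[p]) * c, Ideal.mul_mem_left _ _ (Ideal.sub_mem _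
    (Ideal.mul_mem_left _ _ hc) hb), Ideal.mul_mem_left _ _ hc, ?_, ?_, ?_⟩
  · rw [← he', ← mul_assoc, Units.mul_inv, one_mul]
  · rw [← he', ← mul_assoc, Units.mul_inv, one_mul]
  · -- `(1+T)²·(f ∘ ι) = c(1+T)² − bT(1+T) + T² = C e · f^ι` in `Λ`
    have h1 := one_add_X_mul_iota (p := p)
    have hid : (1 + PowerSeries.X : IwasawaAlgebra p) ^ 2 *
        (invOnePlusSubOne ^ 2 + PowerSeries.C b * invOnePlusSubOne + PowerSeries.C c) =
        PowerSeries.C (e : ℤ_[p]) *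
          ((C 1 * X ^ 2 + C ((↑e⁻¹ : ℤ_[p]) * (2 * c - b)) * X + C ((↑e⁻¹ : ℤ_[p]) * c) : ℤ_[p][X]) :
            IwasawaAlgebra p) := by
      have hE : PowerSeries.C (e : ℤ_[p]) * PowerSeries.C ((↑e⁻¹ : ℤ_[p]) * (2 * c - b)) =
          (2 * PowerSeries.C c - PowerSeries.C b : IwasawaAlgebra p) := by
        rw [← map_mul, ← mul_assoc, Units.mul_inv, one_mul, map_sub, map_mul, map_ofNat]
      have hE' : PowerSeries.C (e : ℤ_[p]) * PowerSeries.C ((↑e⁻¹ : ℤ_[p]) * c) = (PowerSeries.C c : IwasawaAlgebra p) := by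
        rw [← map_mul, ← mul_assoc, Units.mul_inv, one_mul]
      have hCe : PowerSeries.C (e : ℤ_[p]) = (1 - PowerSeries.C b + PowerSeries.C c : IwasawaAlgebra p) := by
        rw [he', map_add, map_sub, map_one]
      simp only [Polynomial.coe_add, Polynomial.coe_mul, Polynomial.coe_pow, Polynomial.coe_C, Polynomial.coe_X,
        map_one, one_mul]
      linear_combination ((1 + PowerSeries.X) * invOnePlusSubOne - PowerSeries.X +
        PowerSeries.C b * (1 + PowerSeries.X)) * h1 - PowerSeries.X ^ 2 * hCe - PowerSeries.X * hE - hE'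
    rw [iota_coe_quadratic, ← Ideal.span_singleton_mul_left_unit (isUnit_one_add_X.pow 2), hid,
      Ideal.span_singleton_mul_left_unit ((Units.isUnit e).map PowerSeries.C)]

/-- **`ι`-conjugate in degree 3.** For `f = T³ + αT² + βT + γ` with `α, β, γ ∈ 𝔪` there is a distinguished cubic
`f^ι = T³ + α′T² + β′T + γ′` (`α′, β′, γ′ ∈ 𝔪`) with `(f ∘ ι)·Λ = (f^ι)·Λ` and `f(−1)·γ′ = γ`, `f(−1) = −1 + α − β + γ`
(`f^ι = f(−1)⁻¹·(γ(1+T)³ − βT(1+T)² + αT²(1+T) − T³)`). [cite: GreenbergLNM1716, §1] [cite: Washington1997, §7.1] -/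
theorem twist_three {α β γ : ℤ_[p]} (hα : α ∈ IsLocalRing.maximalIdeal ℤ_[p]) (hβ : β ∈ IsLocalRing.maximalIdeal ℤ_[p])
    (hγ : γ ∈ IsLocalRing.maximalIdeal ℤ_[p]) :
    ∃ α' β' γ' : ℤ_[p], α' ∈ IsLocalRing.maximalIdeal ℤ_[p] ∧ β' ∈ IsLocalRing.maximalIdeal ℤ_[p] ∧
      γ' ∈ IsLocalRing.maximalIdeal ℤ_[p] ∧ (-1 + α - β + γ) * γ' = γ ∧
      Ideal.span {PowerSeries.subst (invOnePlusSubOne : IwasawaAlgebra p)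
          ((C 1 * X ^ 3 + C α * X ^ 2 + C β * X + C γ : ℤ_[p][X]) : IwasawaAlgebra p)} =
        Ideal.span {((C 1 * X ^ 3 + C α' * X ^ 2 + C β' * X + C γ' : ℤ_[p][X]) : IwasawaAlgebra p)} := by
  have he : IsUnit (-1 + α - β + γ) := by
    have h1 : -1 + α - β + γ = -(1 + (-α + β - γ)) := by ring
    rw [h1]
    exact (isUnit_one_add_of_mem_maximalIdeal
      (Ideal.sub_mem _ (Ideal.add_mem _ (Submodule.neg_mem _ hα) hβ) hγ)).neg
  obtain ⟨e, he'⟩ := he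
  refine ⟨(↑e⁻¹ : ℤ_[p]) * (3 * γ - 2 * β + α), (↑e⁻¹ : ℤ_[p]) * (3 * γ - β), (↑e⁻¹ : ℤ_[p]) * γ,
    Ideal.mul_mem_left _ _ (Ideal.add_mem _ (Ideal.sub_mem _ (Ideal.mul_mem_left _ _ hγ)
      (Ideal.mul_mem_left _ _ hβ)) hα),
    Ideal.mul_mem_left _ _ (Ideal.sub_mem _ (Ideal.mul_mem_left _ _ hγ) hβ), Ideal.mul_mem_left _ _ hγ, ?_, ?_⟩
  · rw [← he', ← mul_assoc, Units.mul_inv, one_mul]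
  · have h1 := one_add_X_mul_iota (p := p)
    have hid : (1 + PowerSeries.X : IwasawaAlgebra p) ^ 3 *
        (invOnePlusSubOne ^ 3 + PowerSeries.C α * invOnePlusSubOne ^ 2 + PowerSeries.C β * invOnePlusSubOne +
          PowerSeries.C γ) =
        PowerSeries.C (e : ℤ_[p]) *
          ((C 1 * X ^ 3 + C ((↑e⁻¹ : ℤ_[p]) * (3 * γ - 2 * β + α)) * X ^ 2 + C ((↑e⁻¹ : ℤ_[p]) * (3 * γ - β)) * X +
            C ((↑e⁻¹ : ℤ_[p]) * γ) : ℤ_[p][X]) : IwasawaAlgebra p) := by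
      have hE2 : PowerSeries.C (e : ℤ_[p]) * PowerSeries.C ((↑e⁻¹ : ℤ_[p]) * (3 * γ - 2 * β + α)) =
          (3 * PowerSeries.C γ - 2 * PowerSeries.C β + PowerSeries.C α : IwasawaAlgebra p) := by
        rw [← map_mul, ← mul_assoc, Units.mul_inv, one_mul, map_add, map_sub, map_mul, map_mul, map_ofNat, map_ofNat]
      have hE1 : PowerSeries.C (e : ℤ_[p]) * PowerSeries.C ((↑e⁻¹ : ℤ_[p]) * (3 * γ - β)) =
          (3 * PowerSeries.C γ - PowerSeries.C β : IwasawaAlgebra p) := by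
        rw [← map_mul, ← mul_assoc, Units.mul_inv, one_mul, map_sub, map_mul, map_ofNat]
      have hE0 : PowerSeries.C (e : ℤ_[p]) * PowerSeries.C ((↑e⁻¹ : ℤ_[p]) * γ) = (PowerSeries.C γ : IwasawaAlgebra p) := by
        rw [← map_mul, ← mul_assoc, Units.mul_inv, one_mul]
      have hCe : PowerSeries.C (e : ℤ_[p]) =
          (-1 + PowerSeries.C α - PowerSeries.C β + PowerSeries.C γ : IwasawaAlgebra p) := by
        rw [he', map_add, map_sub, map_add, map_neg, map_one]
      simp only [Polynomial.coe_add, Polynomial.coe_mul, Polynomial.coe_pow, Polynomial.coe_C, Polynomial.coe_X,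
        map_one, one_mul]
      linear_combination (((1 + PowerSeries.X) * invOnePlusSubOne) ^ 2 -
        ((1 + PowerSeries.X) * invOnePlusSubOne) * PowerSeries.X + PowerSeries.X ^ 2 +
        PowerSeries.C α * (1 + PowerSeries.X) * ((1 + PowerSeries.X) * invOnePlusSubOne - PowerSeries.X) +
        PowerSeries.C β * (1 + PowerSeries.X) ^ 2) * h1 - PowerSeries.X ^ 3 * hCe - PowerSeries.X ^ 2 * hE2 -
        PowerSeries.X * hE1 - hE0
    rw [iota_coe_cubic, ← Ideal.span_singleton_mul_left_unit (isUnit_one_add_X.pow 3), hid,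
      Ideal.span_singleton_mul_left_unit ((Units.isUnit e).map PowerSeries.C)]

/-! ### §3 The digit identities: `T² − σT − σ ∣ F ⟹ σ³ ∣ N_A(σ), σ³ ∣ N_B(σ)` -/

/-- Coefficients of `(T² − σT − σ)·H`: `F_0 = −σH_0`, `F_1 = −σH_0 − σH_1`, `F_{i+2} = H_i − σH_{i+1} − σH_{i+2}`. [folklore] -/
theorem coeff_selfDualQuad_mul (σ : ℤ_[p]) (H : IwasawaAlgebra p) (i : ℕ) :
    PowerSeries.coeff (i + 2) ((PowerSeries.X ^ 2 - PowerSeries.C σ * PowerSeries.X - PowerSeries.C σ) * H) =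
      PowerSeries.coeff i H - σ * PowerSeries.coeff (i + 1) H - σ * PowerSeries.coeff (i + 2) H ∧
    PowerSeries.coeff 0 ((PowerSeries.X ^ 2 - PowerSeries.C σ * PowerSeries.X - PowerSeries.C σ) * H) =
      -(σ * PowerSeries.coeff 0 H) ∧
    PowerSeries.coeff 1 ((PowerSeries.X ^ 2 - PowerSeries.C σ * PowerSeries.X - PowerSeries.C σ) * H) =
      -(σ * PowerSeries.coeff 0 H) - σ * PowerSeries.coeff 1 H := by
  have hexp : (PowerSeries.X ^ 2 - PowerSeries.C σ * PowerSeries.X - PowerSeries.C σ) * H =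
      PowerSeries.X ^ 2 * H - PowerSeries.C σ * (PowerSeries.X * H) - PowerSeries.C σ * H := by ring
  rw [hexp]
  refine ⟨?_, ?_, ?_⟩
  · rw [map_sub, map_sub, PowerSeries.coeff_X_pow_mul, PowerSeries.coeff_C_mul, PowerSeries.coeff_C_mul,
      show i + 2 = (i + 1) + 1 from rfl, PowerSeries.coeff_succ_X_mul]
  · rw [map_sub, map_sub, PowerSeries.coeff_X_pow_mul', if_neg (by omega), PowerSeries.coeff_C_mul,
      PowerSeries.coeff_C_mul, PowerSeries.coeff_zero_X_mul, mul_zero, sub_zero, zero_sub]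
  · rw [map_sub, map_sub, PowerSeries.coeff_X_pow_mul', if_neg (by omega), PowerSeries.coeff_C_mul,
      PowerSeries.coeff_C_mul, show (1 : ℕ) = 0 + 1 from rfl, PowerSeries.coeff_succ_X_mul, zero_sub]

/-- **The digit identities.** If `T² − σT − σ` divides `F` in `Λ`, then
`σ³ ∣ N_A(σ) := F₀ + σF₂ + σ²(F₃ + F₄)` and `σ³ ∣ N_B(σ) := F₁ + σ(F₂ + F₃) + σ²(F₃ + 2F₄ + F₅)`
(indeed `N_A = −σ³(H₂ + 2H₃ + H₄)`, `N_B = −σ³(H₂ + 3H₃ + 3H₄ + H₅)` for `F = (T² − σT − σ)·H`). These are the constant and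
linear coordinates of `F` in `Λ/(T² − σT − σ) = ℤ_p ⊕ ℤ_p·T` truncated modulo `σ³`; a census refutes them, uniformly in
`σ ∈ pℤ_p ∖ {0}`, from finitely many digits of `F₀, …, F₅`. [folklore] -/
theorem pow_three_dvd_of_selfDualQuad_dvd {F : IwasawaAlgebra p} {σ : ℤ_[p]}
    (h : (PowerSeries.X ^ 2 - PowerSeries.C σ * PowerSeries.X - PowerSeries.C σ : IwasawaAlgebra p) ∣ F) :
    σ ^ 3 ∣ PowerSeries.constantCoeff F + σ * PowerSeries.coeff 2 F +
        σ ^ 2 * (PowerSeries.coeff 3 F + PowerSeries.coeff 4 F) ∧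
    σ ^ 3 ∣ PowerSeries.coeff 1 F + σ * (PowerSeries.coeff 2 F + PowerSeries.coeff 3 F) +
        σ ^ 2 * (PowerSeries.coeff 3 F + 2 * PowerSeries.coeff 4 F + PowerSeries.coeff 5 F) := by
  obtain ⟨H, rfl⟩ := h
  obtain ⟨-, h0, h1⟩ := coeff_selfDualQuad_mul σ H 0
  have h2 := (coeff_selfDualQuad_mul σ H 0).1
  have h3 := (coeff_selfDualQuad_mul σ H 1).1
  have h4 := (coeff_selfDualQuad_mul σ H 2).1
  have h5 := (coeff_selfDualQuad_mul σ H 3).1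
  rw [← PowerSeries.coeff_zero_eq_constantCoeff_apply, h0, h1, h2, h3, h4, h5]
  exact ⟨⟨-(PowerSeries.coeff 2 H + 2 * PowerSeries.coeff 3 H + PowerSeries.coeff 4 H), by ring⟩,
    ⟨-(PowerSeries.coeff 2 H + 3 * PowerSeries.coeff 3 H + 3 * PowerSeries.coeff 4 H + PowerSeries.coeff 5 H), by ring⟩⟩

end Summit.BirchSwinnertonDyer.BirchSwinnertonDyer.Theorems.ChromaticIotaDescent

end
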